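import Literature.NumberTheory.EllipticCurves.QuadraticTwistTateFormTwoProofs
import Literature.NumberTheory.EllipticCurves.BSDConductorIsEllipticSaitoThreeProofs
import Literature.NumberTheory.GaloisRepresentations.SqrtUpperRamificationProofs
import HarnessLib

/-!
# Ogg's formula at `2` for the elliptic curves over `ℚ` with `ord₂(j) < 0`, and bsd.S15 for them

`Proofs` file (theorems only, no definitions, no named facts) in topic
`NumberTheory/EllipticCurves`, landed by the seat of bsd.S15
(`Literature.NumberTheory.EllipticCurves.conductorNorm_eq_artinConductorNat`).  It assembles

* the **Galois side** — `Sw_𝔓(V_ℓ E) = 2 · vol {u > 0 : Γ_ℚ^u(𝔓) moves √d}` for a curve `E/ℚ`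
  whose twist `E^{(d)}` is multiplicative at `2` (`swanConductorAt_rationalTate_eq_two_mul_volume`,
  `forall_smul_geomTorsion_eq_iff_le_stabilizer_of_quadraticTwist` of
  `HasseWeilAbelianConductorSwanIndependenceTwoProofs`), the volume being the break `b ∈ {1, 2}`
  of `ℚ₂(√d)` (`Rat.volume_real_setOf_smul_sqrt_ne_of_emod_four_eq_three/_eq_two`,
  `SqrtUpperRamificationProofs`: `b = 1` for `d ≡ 3`, `b = 2` for `d ≡ 2 (mod 4)`), with
* the **discriminant side** — `δ₂(E) = 2`, resp. `4`, for `E ≅ T^{(d)}` with `d ≡ 3`, resp.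
  `2 (mod 4)` (`exists_twist_wildConductorExponent_of_hasAdditiveReductionAt`,
  `QuadraticTwistTateFormTwoProofs`; `d ≡ 1 (mod 4)` being multiplicative),

into **Saito's half of Ogg's formula 11.1 at `p = 2` for every elliptic curve over `ℚ` with
`ord₂(j) < 0`** (the potentially multiplicative ones):
`swanConductorAt_rationalTate_eq_wildConductorExponent_of_ringChar_eq_two_of_one_lt_valuation_j`
proves the named fact
`WeierstrassCurve.swanConductorAt_rationalTate_eq_wildConductorExponent_of_ringChar_eq_two W ℓ`
(`HasseWeilAbelianConductorOggSaito`) for such `W` and every prime `ℓ` — the content of Silverman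
*ATAEC* Thm. IV.10.2(b)/(c) and IV.11.1 at a place of residue characteristic `2` with `v(j) < 0`
("`E` is a quadratic twist of a Tate curve", PDF pp. 359–360, combined with the conductor of the
twisting character at `2`).  Consequently (`conductorNorm_eq_artinConductorNat_of_isElliptic_of_one_lt_valuation_j`,
`conductor_eq_conductorOf_mul_of_isElliptic_of_one_lt_valuation_j`,
`conductorNorm_eq_artinConductorNat_of_one_lt_valuation_j`) the bsd.S15 facts
`N_E = N^{(ℓ)}(V_ℓ E)` (corrected and schema forms) and `𝔣(E/ℚ) = 𝔣^{(ℓ)}(V_ℓ E)·(ℓ)^{f_ℓ}` hold,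
unconditionally and for every prime `ℓ`, for every elliptic curve over `ℚ` with `ord₂(j) < 0`.
What remains of Saito's theorem over `ℚ` is the case of potentially good, additive reduction at
`2`.

## References

* J. H. Silverman, *Advanced Topics in the Arithmetic of Elliptic Curves*, GTM 151 (1994),
  Thm. IV.10.2 and its proof, case `v(j) < 0` (PDF pp. 358–362); Thm. IV.11.1 (p. 365; p. 366
  for `p = 2`). [SilvermanATAEC1994]
* T. Saito, *Conductor, discriminant, and the Noether formula of arithmetic surfaces*, Duke
  Math. J. 57 (1988), Thm. 1 (cited only). [Saito1988]
* J.-P. Serre, *Local Fields*, GTM 67 (1979), Ch. IV §§1, 3; Ch. VI §2. [SerreLocalFields1979]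
-/

noncomputable section

open scoped Classical NumberField
open IsDedekindDomain Field Rat.HeightOneSpectrum Literature.NumberTheory.EllipticCurves
  Literature.NumberTheory.GaloisRepresentations Literature.NumberTheory.DiophantineGeometry

namespace WeierstrassCurve

variable (W : WeierstrassCurve ℚ)

/-! ### The place above `2` -/

/-- Two places of `ℚ` containing `2` coincide (both are `(2)`). [folklore] -/
theorem Rat.heightOneSpectrum_eq_of_two_mem {v w : HeightOneSpectrum (𝓞 ℚ)}
    (hv : (2 : 𝓞 ℚ) ∈ v.asIdeal) (hw : (2 : 𝓞 ℚ) ∈ w.asIdeal) : v = w := by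
  apply HeightOneSpectrum.ext
  rw [Rat.asIdeal_eq_span_natGenerator v, Rat.asIdeal_eq_span_natGenerator w,
    Rat.natGenerator_eq_two hv, Rat.natGenerator_eq_two hw]

/-! ### The twist `E^{(d)}` is multiplicative at `2` when `C • E = T^{(d)}` -/

/-- If `C • W = T^{(d)}` with `T = tateFormOfJ j(W)` and `ord_v(j) < 0`, then `W^{(d)}` has
multiplicative reduction at `v`: `W^{(d)} ≅ (C • W)^{(d)} = T^{(d²)} ≅ T^{(1)} ≅ T` over `ℚ`
(`quadraticTwist_smul`, `quadraticTwist_quadraticTwist`, `exists_variableChange_quadraticTwist_mul_sq`,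
`exists_variableChange_quadraticTwist_one`) and `T` is multiplicative at `v`
(`hasMultiplicativeReductionAt_tateFormOfJ_of_one_lt_valuation_j`).  Silverman *AEC* X.5
Cor. 5.4.1; *ATAEC* V.5 Lemma 5.1. [cite: SilvermanAEC2009, X.5 Cor. 5.4.1] [cite: SilvermanATAEC1994, V.5 Lemma 5.1] -/
theorem hasMultiplicativeReductionAt_quadraticTwist_of_eq_quadraticTwist_tateFormOfJ [W.IsElliptic]
    (v : HeightOneSpectrum (𝓞 ℚ)) (hj : 1 < v.valuation ℚ W.j) {d : ℤ} (hd0 : d ≠ 0)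
    {C : VariableChange ℚ} (hC : C • W = (tateFormOfJ W.j).quadraticTwist (d : ℚ)) :
    (W.quadraticTwist (d : ℚ)).HasMultiplicativeReductionAt v := by
  obtain ⟨hj0, hj1728, -⟩ := W.j_ne_and_valuation_j_sub_eq_of_one_lt_valuation_j v hj
  haveI := isElliptic_tateFormOfJ hj0 hj1728
  set T := tateFormOfJ W.j with hT
  have hd0' : (d : ℚ) ≠ 0 := by exact_mod_cast hd0
  haveI : (W.quadraticTwist (d : ℚ)).IsElliptic := W.isElliptic_quadraticTwist hd0'
  haveI : (T.quadraticTwist 1).IsElliptic := T.isElliptic_quadraticTwist one_ne_zero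
  haveI : (T.quadraticTwist ((d : ℚ) * d)).IsElliptic := T.isElliptic_quadraticTwist (mul_ne_zero hd0' hd0')
  have hT : T.HasMultiplicativeReductionAt v := W.hasMultiplicativeReductionAt_tateFormOfJ_of_one_lt_valuation_j v hj
  -- `T^{(1)} ≅ T`, `T^{(d²)} ≅ T^{(1)}`
  obtain ⟨C₁, hC₁⟩ := T.exists_variableChange_quadraticTwist_one
  have h1 : (T.quadraticTwist 1).HasMultiplicativeReductionAt v := by
    rw [← hC₁]; exact (hasMultiplicativeReductionAt_smul_iff_holds v T C₁).mpr hT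
  obtain ⟨C₂, hC₂⟩ := T.exists_variableChange_quadraticTwist_mul_sq 1 (d : ℚ) hd0'
  rw [one_mul, sq] at hC₂
  have h2 : (T.quadraticTwist ((d : ℚ) * d)).HasMultiplicativeReductionAt v := by
    rw [← hC₂]; exact (hasMultiplicativeReductionAt_smul_iff_holds v _ C₂).mpr h1
  -- `W^{(d)} ≅ (C • W)^{(d)} = T^{(d·d)}`
  have h3 : (⟨C.u, (d : ℚ) * C.r, 0, 0⟩ : VariableChange ℚ) • W.quadraticTwist (d : ℚ) =
      T.quadraticTwist ((d : ℚ) * d) := by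
    rw [← quadraticTwist_smul, hC, quadraticTwist_quadraticTwist]
  rw [← hasMultiplicativeReductionAt_smul_iff_holds v (W.quadraticTwist (d : ℚ))
    (⟨C.u, (d : ℚ) * C.r, 0, 0⟩ : VariableChange ℚ), h3]
  exact h2

/-! ### The Galois side: `Sw_𝔓(V_ℓ E) = 2 · vol {u > 0 : Γ_ℚ^u(𝔓) moves √d}` -/

variable (ℓ : ℕ) [Fact ℓ.Prime]

/-- **The wild conductor of a ramified quadratic twist of a Tate curve.**  For an elliptic `W/ℚ`,
a place `v ∌ ℓ` with `ℓ` odd, `d ≠ 0` with `W^{(d)}` multiplicative at `v`, and `𝔓 ∣ v`: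
`Sw_𝔓(V_ℓ E) = 2 · vol {u > 0 : some σ ∈ Γ_ℚ^u(𝔓) has σ√d ≠ √d}` — the Swan conductor is the
integral of `codim (V_ℓ E)^{Γ^u} ∈ {0, 2}` (`swanConductorAt_rationalTate_eq_two_mul_volume`), and
`Γ^u` (`u > 0`) fixes `E[ℓ]` iff it fixes `√d`
(`forall_smul_geomTorsion_eq_iff_le_stabilizer_of_quadraticTwist`).  This is `δ(E) = 2δ(χ_d)`,
the case `v(j) < 0` of Silverman *ATAEC* Thm. IV.10.2(b)–(c) in residue characteristic `2`.
[cite: SilvermanATAEC1994, Thm. IV.10.2(b),(c) and proof, case v(j) < 0 (PDF pp. 358–362)] -/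
theorem swanConductorAt_rationalTate_eq_two_mul_volume_smul_geomSqrt_ne [W.IsElliptic]
    (h : Continuous fun x : absoluteGaloisGroup ℚ × RationalTateModule (geomPoints W) ℓ ↦
      rationalTateRepresentation (absoluteGaloisGroup ℚ) (geomPoints W) ℓ x.1 x.2)
    {v : HeightOneSpectrum (𝓞 ℚ)} (hℓ : (ℓ : 𝓞 ℚ) ∉ v.asIdeal) (hℓ2 : ℓ ≠ 2)
    {d : ℚ} (hd : d ≠ 0) (hmult : (W.quadraticTwist d).HasMultiplicativeReductionAt v)
    {𝔓 : Ideal (absIntegers (𝓞 ℚ) ℚ)} (h𝔓 : 𝔓 ∈ v.primesAbove) :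
    (rationalTateGaloisRepOf (geomPoints W) ℓ h).swanConductorAt (𝓞 ℚ) 𝔓 =
      2 * MeasureTheory.volume.real {u : ℝ | 0 < u ∧
        ∃ σ ∈ absUpperRamificationSubgroup (𝓞 ℚ) 𝔓 u, σ • geomSqrt d ≠ geomSqrt d} := by
  rw [W.swanConductorAt_rationalTate_eq_two_mul_volume ℓ h hℓ h𝔓]
  congr 2
  ext u
  simp only [Set.mem_setOf_eq]
  refine and_congr_right fun hu ↦ ?_
  have key := W.forall_smul_geomTorsion_eq_iff_le_stabilizer_of_quadraticTwist ℓ hℓ hℓ2 hd hmult h𝔓 hu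
  constructor
  · rintro ⟨σ, hσ, T, hT⟩
    by_contra hno
    push Not at hno
    have hle : absUpperRamificationSubgroup (𝓞 ℚ) 𝔓 u ≤
        MulAction.stabilizer (absoluteGaloisGroup ℚ) (geomSqrt d) :=
      fun τ hτ ↦ MulAction.mem_stabilizer_iff.mpr (hno τ hτ)
    exact hT (key.mpr hle σ hσ T)
  · rintro ⟨σ, hσ, hne⟩
    by_contra hno
    push Not at hno
    exact hne (MulAction.mem_stabilizer_iff.mp (key.mp (fun τ hτ T ↦ hno τ hτ T) hσ))

/-! ### Saito's half of Ogg's formula at `2` for `ord₂(j) < 0` -/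

/-- **Ogg's formula at `2`, wild part, for the elliptic curves over `ℚ` with `ord₂(j) < 0`**
(Silverman *ATAEC* IV.11.1 with IV.10.2(b): Saito's half at the potentially multiplicative
places).  Let `W/ℚ` be elliptic with `1 < |j|₂` (i.e. `ord₂(j) < 0`).  Then the named fact
`swanConductorAt_rationalTate_eq_wildConductorExponent_of_ringChar_eq_two W ℓ` holds for every
prime `ℓ`: at the (unique) place `v` of residue characteristic `2`, if `W` is additive there,
write `C • W = T^{(d)}` with `d ∈ ℤ`, `4 ∤ d` (`exists_twist_wildConductorExponent_of_hasAdditiveReductionAt`);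
then `δ_v = 2`, resp. `4`, as `d ≡ 3`, resp. `2 (mod 4)` (Tate's algorithm), while
`Sw_𝔓(V_ℓ E) = 2 · vol {u > 0 : Γ^u moves √d} = 2 · 1`, resp. `2 · 2` (the break of `ℚ₂(√d)`).
[cite: SilvermanATAEC1994, Thm. IV.11.1 (PDF p. 365) with Thm. IV.10.2(b),(c), case v(j) < 0 (pp. 359–362)]
[cite: Saito1988, Theorem 1] [cite: SerreLocalFields1979, Ch. IV §§1, 3] -/
theorem swanConductorAt_rationalTate_eq_wildConductorExponent_of_ringChar_eq_two_of_one_lt_valuation_j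
    (hj : ∀ [W.IsElliptic] (v : HeightOneSpectrum (𝓞 ℚ)), (2 : 𝓞 ℚ) ∈ v.asIdeal →
      1 < v.valuation ℚ W.j) :
    W.swanConductorAt_rationalTate_eq_wildConductorExponent_of_ringChar_eq_two ℓ := by
  intro _ h v hℓ hadd h2 𝔓 h𝔓
  -- the place `v` is the place above `2`
  have hv2 : (2 : 𝓞 ℚ) ∈ v.asIdeal := by
    have := v.natCast_ringChar_mem; rwa [h2, Nat.cast_ofNat] at this
  have hv : natGenerator v = 2 := Rat.natGenerator_eq_two hv2
  have hℓ2 : ℓ ≠ 2 := by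
    rintro rfl; exact hℓ (by exact_mod_cast hv2)
  haveI := perfectField_residueField_adicCompletionIntegers (K := ℚ) v
  -- discriminant side
  obtain ⟨d, hd0, ⟨C, hC⟩, hcases⟩ :=
    W.exists_twist_wildConductorExponent_of_hasAdditiveReductionAt v hv (hj v hv2) hadd
  -- Galois side
  have hmult := W.hasMultiplicativeReductionAt_quadraticTwist_of_eq_quadraticTwist_tateFormOfJ v
    (hj v hv2) hd0 hC
  have hd0' : (d : ℚ) ≠ 0 := by exact_mod_cast hd0
  rw [W.swanConductorAt_rationalTate_eq_two_mul_volume_smul_geomSqrt_ne ℓ h hℓ hℓ2 hd0' hmult h𝔓]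
  have hs : geomSqrt (d : ℚ) ^ 2 = algebraMap ℚ (AlgebraicClosure ℚ) (d : ℚ) := geomSqrt_sq _
  rcases hcases with ⟨hd3, hδ⟩ | ⟨hd2, hδ⟩
  · rw [Rat.volume_real_setOf_smul_sqrt_ne_of_emod_four_eq_three hd3 hs hv2 h𝔓, hδ]; norm_num
  · rw [Rat.volume_real_setOf_smul_sqrt_ne_of_emod_four_eq_two hd2 hs hv2 h𝔓, hδ]; norm_num

/-- The same with the hypothesis at one place `v₂ ∋ 2` (the place above `2` is unique).
[cite: SilvermanATAEC1994, Thm. IV.11.1 (PDF p. 365) with Thm. IV.10.2(b),(c), case v(j) < 0 (pp. 359–362)] -/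
theorem swanConductorAt_rationalTate_eq_wildConductorExponent_of_ringChar_eq_two_of_one_lt_valuation_j'
    {v₂ : HeightOneSpectrum (𝓞 ℚ)} (hv₂ : (2 : 𝓞 ℚ) ∈ v₂.asIdeal)
    (hj : ∀ [W.IsElliptic], 1 < v₂.valuation ℚ W.j) :
    W.swanConductorAt_rationalTate_eq_wildConductorExponent_of_ringChar_eq_two ℓ :=
  W.swanConductorAt_rationalTate_eq_wildConductorExponent_of_ringChar_eq_two_of_one_lt_valuation_j ℓ
    fun v hv ↦ by rw [Rat.heightOneSpectrum_eq_of_two_mem hv hv₂]; exact hj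

end WeierstrassCurve

/-! ### bsd.S15 for the elliptic curves over `ℚ` with `ord₂(j) < 0` -/

namespace Literature.NumberTheory.EllipticCurves

open _root_.WeierstrassCurve

variable (W : WeierstrassCurve ℚ) (ℓ : ℕ) [Fact ℓ.Prime]

/-- **bsd.S15, corrected form `N_E = N^{(ℓ)}(V_ℓ E)`, for every prime `ℓ` and every elliptic
curve over `ℚ` with `ord₂(j) < 0`** — unconditionally: Saito's half of Ogg's formula at `2` holds
for such curves (`…_of_ringChar_eq_two_of_one_lt_valuation_j`, at `ℓ = 3`), and the fact follows
from it (`conductorNorm_eq_artinConductorNat_of_isElliptic_of_two_three`,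
`HasseWeilAbelianConductorSwanIndependenceTwoProofs`).  Silverman *ATAEC* §IV.10 (Definition of
the conductor, PDF p. 364) with Thm. IV.10.2 (p. 358) and Thm. IV.11.1 (pp. 365–371).
[cite: SilvermanATAEC1994, §IV.10 Definition (PDF p. 364), Thm. IV.10.2 (p. 358), Thm. IV.11.1 (pp. 365–371)] -/
theorem conductorNorm_eq_artinConductorNat_of_isElliptic_of_one_lt_valuation_j
    (hj : ∀ [W.IsElliptic] (v : HeightOneSpectrum (𝓞 ℚ)), (2 : 𝓞 ℚ) ∈ v.asIdeal →
      1 < v.valuation ℚ W.j) :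
    conductorNorm_eq_artinConductorNat_of_isElliptic W ℓ :=
  haveI : Fact (Nat.Prime 3) := ⟨Nat.prime_three⟩
  conductorNorm_eq_artinConductorNat_of_isElliptic_of_two_three W ℓ
    (W.swanConductorAt_rationalTate_eq_wildConductorExponent_of_ringChar_eq_two_of_one_lt_valuation_j 3 hj)

/-- **The seat's schema `conductorNorm_eq_artinConductorNat W ℓ` at an elliptic `W/ℚ` with
`ord₂(j) < 0`, every `ℓ`** (the schema is false at singular `W`, whence the instance hypothesis).
[cite: SilvermanATAEC1994, §IV.10 Definition (PDF p. 364), Thm. IV.10.2 (p. 358), Thm. IV.11.1 (pp. 365–371)] -/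
theorem conductorNorm_eq_artinConductorNat_of_one_lt_valuation_j [W.IsElliptic]
    (hj : ∀ v : HeightOneSpectrum (𝓞 ℚ), (2 : 𝓞 ℚ) ∈ v.asIdeal → 1 < v.valuation ℚ W.j) :
    conductorNorm_eq_artinConductorNat W ℓ :=
  haveI : Fact (Nat.Prime 3) := ⟨Nat.prime_three⟩
  conductorNorm_eq_artinConductorNat_of_two_three W ℓ
    (W.swanConductorAt_rationalTate_eq_wildConductorExponent_of_ringChar_eq_two_of_one_lt_valuation_j 3
      fun v hv ↦ hj v hv)

/-- **bsd.S15 (d), corrected ideal form `𝔣(E/ℚ) = 𝔣^{(ℓ)}(V_ℓ E) · (ℓ)^{f_ℓ}`, for every prime `ℓ`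
and every elliptic curve over `ℚ` with `ord₂(j) < 0`** (via
`conductor_eq_conductorOf_mul_of_isElliptic_of_two_three`, `BSDConductorIsEllipticSaitoThreeProofs`).
[cite: SilvermanATAEC1994, §IV.10 Definition (PDF p. 364), Thm. IV.10.2 (p. 358), Thm. IV.11.1 (pp. 365–371)] -/
theorem conductor_eq_conductorOf_mul_of_isElliptic_of_one_lt_valuation_j
    (hj : ∀ [W.IsElliptic] (v : HeightOneSpectrum (𝓞 ℚ)), (2 : 𝓞 ℚ) ∈ v.asIdeal →
      1 < v.valuation ℚ W.j) :
    conductor_eq_conductorOf_mul_of_isElliptic W ℓ :=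
  haveI : Fact (Nat.Prime 3) := ⟨Nat.prime_three⟩
  conductor_eq_conductorOf_mul_of_isElliptic_of_two_three W ℓ
    (W.swanConductorAt_rationalTate_eq_wildConductorExponent_of_ringChar_eq_two_of_one_lt_valuation_j 3 hj)

end Literature.NumberTheory.EllipticCurves

end
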